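/-
Copyright (c) 2026 the pub-hodgecm-mathlib formalisation cell (harness21).  Prover seat hodgecm-mathlib-K2E3-p27 (g2), R90-TF SLAB section S4
(Rogawski Ch. 13.1–2), hand S4#C-NORM «NORM MAP & TWISTED CONJUGACY» of the S4 dealer K2E2-plan (g6) (R90 bus 2026-09-04T16:01:31Z, returned to the
pool 16:04:57Z, taken 16:06:09Z); h413 = `stmt-HodgeConjecture-24833`.
-/
import Literature.NumberTheory.Rogawski1990.Ch4Sec10Bridge                             -- ★ `mem_epsCentralizer_iff`, `isEpsConj_iff_exists_inv` (brings ★ `Ch4Sec10`: `IsEpsConj`, `epsCentralizer`, `epsNorm`, `IsEpsNorm`, `IsStablyEpsConj`)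
import Literature.NumberTheory.Kottwitz1992.FixedPointCount                           -- ★ `twistedCentralizer σ δ` (the `TO_δ` currency)
import Summits.HodgeConjecture.HodgeConjecture.Theorems.K2E1TwistEpsilonInvolution    -- ★ `unitaryTwist_unitaryTwist` (any ring: `ε ∘ ε = id` for `σ`-hermitian `Φ`)
import HarnessLib

/-!
# R90 · S4 (Ch. 13.1–2) · C-NORM — twisted conjugacy is an equivalence relation, the norm map `N(δ) = δ ε(δ)` descends from ε-classes to classes,
# and the ε-centralizers along an ε-class are conjugate

Cell `pub/hodgecm-mathlib`, crux H413 = `stmt-HodgeConjecture-24833`, route of record `HCCMUnconditional`; R90-TF SLAB section S4, hand C-NORM by name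
(S4 dealer K2E2-plan (g6); chair K2-lead (g2)).  THEOREMS ONLY over the tree's ★ CURRENCY — no definition, no instance, no notation, no named-fact hypothesis,
no `sorry`; lane `--kind proof --supports stmt-HodgeConjecture-24833 --as helper`; namespace `Summit.HodgeConjecture.HodgeConjecture.R90.S4`.

CENSUS (2026-09-04T16:06Z, why there is no new `def` here).  The deal text asked for `twistConj ∕ normElt ∕ IsNormPair`; these objects are ALREADY ★ under
★ `Literature.NumberTheory.Rogawski1990.Ch4Sec10` for an abstract group `G̃` with an endomorphism `ε : G̃ →* G̃`: ε-conjugacy `IsEpsConj ε δ δ′ := ∃ y, y δ ε(y)⁻¹ = δ′`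
[§1.4 p. 4], the ε-centralizer `epsCentralizer ε δ = {g : g δ ε(g)⁻¹ = δ}` [§1.4 p. 4] (unfoldings ★ `Ch4Sec10Bridge.mem_epsCentralizer_iff ∕ iff'`), the norm
`epsNorm ε δ := δ ε(δ)` [§3.10 p. 33; §3.11 p. 34], and on `G̃ = GL_n(R)` with the unitary twist `ε = unitaryTwist σ Φ`: `IsEpsNorm σ Φ δ γ := IsConj (N δ) γ` («`γ ∈ 𝒩(δ)`»)
and `IsStablyEpsConj σ Φ δ δ′ := IsConj (N δ) (N δ′)` [§3.11 p. 34]; ★ `Kottwitz1992.FixedPointCount.twistedCentralizer σ δ` is the same subgroup in the `TO_δ` currency.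
So this file re-sockets nothing (law C4) and proves, about those ★ names:
* §1 (any group, any `ε`) `IsEpsConj ε` is an EQUIVALENCE RELATION (`isEpsConj_refl`, `isEpsConj_symm`, `isEpsConj_trans`, `isEpsConj_comm`, `equivalence_isEpsConj`),
  `isEpsConj_mul_mul_inv` (the orbit map `y ↦ y δ ε(y)⁻¹`), and the CENTRALIZER TRANSPORT `map_conj_epsCentralizer : (G̃_{δε}).map Ad(y) = G̃_{(y δ ε(y)⁻¹) ε}`
  (conjugate ε-centralizers along an ε-class — the change of base point in `TO_δ`), plus the bridge `epsCentralizer_eq_twistedCentralizer` (R90 ↔ Kottwitz currency);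
* §2 (`ε ∘ ε = id`) THE NORM DESCENDS: `epsNorm_mul_mul_inv : N(y δ ε(y)⁻¹) = y N(δ) y⁻¹`, hence `isConj_epsNorm_of_isEpsConj : δ ~_ε δ′ → N(δ) ~ N(δ′)` (the well-definedness
  of `N : {ε-classes} → {classes}`, §3.11 p. 34 «the stable conjugacy class of `N(δ)` … depends only on the ε-conjugacy class of `δ`»), `apply_epsNorm` (`ε(Nδ) = δ⁻¹ (Nδ) δ`,
  the norm is conjugate to its own twist — generic form of ★ `isConj_epsNorm_unitaryTwist_epsNorm`), `epsNorm_mem_epsCentralizer` (`N(δ) ∈ G̃_{δε}`);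
* §3 (`G̃ = GL_n(R)`, `σ` an involution, `Φ` `σ`-hermitian — ★ `K2E1TwistEpsilonInvolution.unitaryTwist_unitaryTwist`) the §3.11 relations descend: `isEpsNorm_of_isEpsConj`
  (the `δ`-slot of «`γ ∈ 𝒩(δ)`» is ε-class invariant), `isEpsNorm_of_isConj` (the `γ`-slot is conjugacy invariant), `isStablyEpsConj_of_isEpsConj` (ε-conjugate ⇒ stably ε-conjugate),
  `equivalence_isStablyEpsConj`, `isStablyEpsConj_of_isEpsNorm` (two `δ`'s with a common norm are stably ε-conjugate — the injectivity half of Prop. 3.11.1 (c)).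
These are the C-D2 ingredients of the twisted transfer `φ → f` (S4 FILE C ED. 2: the norm map `G̃_v → G_v` on classes).
* §4 (ED. 2; item contributed by K2E3-p34 (g2)'s superseded draft, R90 bus 16:08:48Z) (3.10.1) **`epsCentralizer_le_centralizer_epsNorm : G̃_{δε} ≤ G̃_{N(δ)}`** for `ε ∘ ε = id`
  (`mul_epsNorm_mul_inv_eq_of_mem_epsCentralizer`, `commute_epsNorm_of_mem_epsCentralizer`).

HONEST LABEL.  Count-neutral helper (closes no socket; proves no printed theorem beyond the §1.4∕§3.11 bookkeeping identities); HC_CM is proved only modulo the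
7 printed citations (2 remaining named inputs: hLiu418 = `stmt-HodgeConjecture-24832`, h413 = `stmt-HodgeConjecture-24833`) until rung 0 closes; REL ≠ ★ ≠ BUILT.

## References
* [Rogawski1990] J. D. Rogawski, *Automorphic Representations of Unitary Groups in Three Variables*, Ann. of Math. Stud. 123 (1990): §1.4 p. 4 (ε-conjugacy,
  `G(δε)`), §3.10 p. 33 (`N(δ) = δ ε(δ)`), §3.11 pp. 34–35 (`𝒩(δ)`, Prop. 3.11.1, stable ε-conjugacy), §4.10–§4.11 pp. 57–60 (twisted orbital integrals, `φ → f`).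
* [Kottwitz1992] R. E. Kottwitz, *Points on some Shimura varieties over finite fields*, J. Amer. Math. Soc. 5 (1992), §16 p. 432 (twisted centralizer `G_{δσ}`, `TO_δ`).
* [ArthurClozelAMS120] J. Arthur, L. Clozel, *Simple algebras, base change, and the advanced theory of the trace formula*, Ann. of Math. Stud. 120 (1989), Ch. 1 §1
  (σ-conjugacy and the norm map for `GL(n)`; Lemma 1.1: `N` induces an injection of σ-classes into classes).
-/

set_option autoImplicit false
-- the mandated namespace repeats `HodgeConjecture.HodgeConjecture`, as in every `Theorems/*.lean` of this sub-problem
set_option linter.dupNamespace false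

noncomputable section

open scoped MatrixGroups Matrix

namespace Summit.HodgeConjecture.HodgeConjecture.R90.S4

open Literature.NumberTheory.Rogawski1990.Ch4Sec10
open Literature.AlgebraicGeometry.ShimuraVarieties (unitaryGroup)

/-! ## §1 ε-conjugacy is an equivalence relation; ε-centralizers along an ε-class are conjugate -/

section Abstract

variable {G : Type*} [Group G] (ε : G →* G)

/-- `δ` is ε-conjugate to itself (`y = 1`). [cite: Rogawski1990, §1.4 p. 4] -/
theorem isEpsConj_refl (δ : G) : IsEpsConj ε δ δ :=
  ⟨1, by rw [map_one, inv_one, one_mul, mul_one]⟩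

/-- The ε-orbit map: `δ` is ε-conjugate to `y δ ε(y)⁻¹` for every `y` (print: «`x, y` are ε-conjugate if `g⁻¹ x ε(g) = y`», here `g = y⁻¹`). [cite: Rogawski1990, §1.4 p. 4] -/
theorem isEpsConj_mul_mul_inv (y δ : G) : IsEpsConj ε δ (y * δ * (ε y)⁻¹) :=
  ⟨y, rfl⟩

variable {ε} in
/-- ε-conjugacy is SYMMETRIC: if `y δ ε(y)⁻¹ = δ′` then `y⁻¹ δ′ ε(y⁻¹)⁻¹ = δ`. [cite: Rogawski1990, §1.4 p. 4] -/
theorem isEpsConj_symm {δ δ' : G} (h : IsEpsConj ε δ δ') : IsEpsConj ε δ' δ := by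
  obtain ⟨y, rfl⟩ := h
  refine ⟨y⁻¹, ?_⟩
  rw [map_inv, inv_inv]
  group

variable {ε} in
/-- ε-conjugacy is TRANSITIVE: `z (y δ ε(y)⁻¹) ε(z)⁻¹ = (z y) δ ε(z y)⁻¹`. [cite: Rogawski1990, §1.4 p. 4] -/
theorem isEpsConj_trans {δ δ' δ'' : G} (h : IsEpsConj ε δ δ') (h' : IsEpsConj ε δ' δ'') : IsEpsConj ε δ δ'' := by
  obtain ⟨y, rfl⟩ := h
  obtain ⟨z, rfl⟩ := h'
  refine ⟨z * y, ?_⟩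
  rw [map_mul, mul_inv_rev]
  group

/-- ε-conjugacy is symmetric as an `iff`. [cite: Rogawski1990, §1.4 p. 4] -/
theorem isEpsConj_comm (δ δ' : G) : IsEpsConj ε δ δ' ↔ IsEpsConj ε δ' δ :=
  ⟨isEpsConj_symm, isEpsConj_symm⟩

/-- **ε-CONJUGACY IS AN EQUIVALENCE RELATION on `G̃`** (for ANY endomorphism `ε`; no involutivity needed) — so «the ε-conjugacy classes `𝒪_ε(G̃)`» of §1.4 ∕ §3.11
and the index sets of (4.10.1) are classes of a genuine `Setoid` (cf. ★ `EpsConjClassesMod`, the `mod Z′` version). [cite: Rogawski1990, §1.4 p. 4; §3.11 p. 34] -/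
theorem equivalence_isEpsConj : Equivalence (IsEpsConj ε) :=
  ⟨isEpsConj_refl ε, isEpsConj_symm, isEpsConj_trans⟩

/-- **CONJUGATE ε-CENTRALIZERS ALONG AN ε-CLASS**: `Ad(y)` carries `G̃_{δε}` onto `G̃_{δ′ε}` for `δ′ = y δ ε(y)⁻¹` — for `c δ ε(c)⁻¹ = δ`,
`(y c y⁻¹) δ′ ε(y c y⁻¹)⁻¹ = y (c δ ε(c)⁻¹) ε(y)⁻¹ = δ′` (the change of base point `δ ↦ δ′` in the twisted orbital integral `TO_δ`, §4.10; Mathlib `Subgroup.map` along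
`MulAut.conj y`). [cite: Rogawski1990, §1.4 p. 4; §4.10 p. 57] [cite: Kottwitz1992, §16 p. 432] -/
theorem map_conj_epsCentralizer (y δ : G) :
    (epsCentralizer ε δ).map (MulAut.conj y).toMonoidHom = epsCentralizer ε (y * δ * (ε y)⁻¹) := by
  ext c
  rw [Subgroup.mem_map_equiv, mem_epsCentralizer_iff, mem_epsCentralizer_iff, MulAut.conj_symm_apply, map_mul, map_mul, map_inv]
  constructor
  · intro h
    calc c * (y * δ * (ε y)⁻¹) * (ε c)⁻¹ = y * (y⁻¹ * c * y * δ * ((ε y)⁻¹ * ε c * ε y)⁻¹) * (ε y)⁻¹ := by group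
      _ = y * δ * (ε y)⁻¹ := by rw [h]
  · intro h
    calc y⁻¹ * c * y * δ * ((ε y)⁻¹ * ε c * ε y)⁻¹ = y⁻¹ * (c * (y * δ * (ε y)⁻¹) * (ε c)⁻¹) * ε y := by group
      _ = y⁻¹ * (y * δ * (ε y)⁻¹) * ε y := by rw [h]
      _ = δ := by group

/-- A member of an ε-class has an ε-centralizer CONJUGATE to that of the base point: `δ ~_ε δ′ ⇒ ∃ y, Ad(y)(G̃_{δε}) = G̃_{δ′ε}`. [cite: Rogawski1990, §1.4 p. 4; §4.10 p. 57] -/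
theorem exists_map_conj_epsCentralizer_eq_of_isEpsConj {ε : G →* G} {δ δ' : G} (h : IsEpsConj ε δ δ') :
    ∃ y : G, (epsCentralizer ε δ).map (MulAut.conj y).toMonoidHom = epsCentralizer ε δ' := by
  obtain ⟨y, rfl⟩ := h
  exact ⟨y, map_conj_epsCentralizer ε y δ⟩

/-- **BRIDGE R90 ↔ KOTTWITZ**: the ε-centralizer ★ `Ch4Sec10.epsCentralizer ε δ` IS the twisted centralizer ★ `Kottwitz1992.FixedPointCount.twistedCentralizer ε δ`
(both are `{c : c δ ε(c)⁻¹ = δ}`; the two ★ files spell the equaliser through `MulAut.conj δ⁻¹` resp. `(MulAut.conj δ)⁻¹`), so the `TO_δ` currency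
(★ `twistedOrbitalIntegral`) and the (4.10.1) currency (★ `epsOrbitalIntegral`) quotient by the same subgroup. [cite: Kottwitz1992, §16 p. 432] [cite: Rogawski1990, §1.4 p. 4] -/
theorem epsCentralizer_eq_twistedCentralizer (δ : G) :
    epsCentralizer ε δ = Literature.NumberTheory.Kottwitz1992.FixedPointCount.twistedCentralizer ε δ := by
  ext c
  rw [mem_epsCentralizer_iff']
  change _ ↔ ((MulAut.conj δ)⁻¹ : MulAut G) c = ε c
  rw [MulAut.conj_inv_apply]
  constructor
  · intro h
    calc δ⁻¹ * c * δ = δ⁻¹ * c * (c⁻¹ * δ * ε c) := by rw [h]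
      _ = ε c := by group
  · intro h
    calc c⁻¹ * δ * ε c = c⁻¹ * δ * (δ⁻¹ * c * δ) := by rw [h]
      _ = δ := by group

end Abstract

/-! ## §2 The norm `N(δ) = δ ε(δ)` for an involution `ε`: `N` descends from ε-classes to conjugacy classes -/

section Norm

variable {G : Type*} [Group G] (ε : G →* G)

/-- **`N(y δ ε(y)⁻¹) = y N(δ) y⁻¹`** for `ε ∘ ε = id`: `y δ ε(y)⁻¹ · ε(y) ε(δ) ε(ε(y))⁻¹ = y δ ε(δ) y⁻¹` (the public, group-generic form of the tree's private
`epsNorm_epsConj` of ★ `Ch3Sec12Prop3121aLocalHolds` ∕ ★ `Ch3Sec13Prop3132aPadicHolds`). [cite: Rogawski1990, §3.11 p. 34] [cite: ArthurClozelAMS120, Ch. 1 §1 Lemma 1.1] -/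
theorem epsNorm_mul_mul_inv (hε : ∀ g : G, ε (ε g) = g) (y δ : G) :
    epsNorm ε (y * δ * (ε y)⁻¹) = y * epsNorm ε δ * y⁻¹ := by
  simp only [epsNorm, map_mul, map_inv, hε]
  group

variable {ε} in
/-- **THE NORM MAP DESCENDS TO CLASSES**: ε-conjugate elements have CONJUGATE norms, `δ ~_ε δ′ ⇒ N(δ) ~ N(δ′)` (Mathlib `IsConj`) — «the stable conjugacy class of
`N(δ)` … depends only on the ε-conjugacy class of `δ`», i.e. `N : 𝒪_ε(G̃) → 𝒪(G̃)` is well defined. [cite: Rogawski1990, §3.11 p. 34] [cite: ArthurClozelAMS120, Ch. 1 §1 Lemma 1.1] -/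
theorem isConj_epsNorm_of_isEpsConj (hε : ∀ g : G, ε (ε g) = g) {δ δ' : G} (h : IsEpsConj ε δ δ') :
    IsConj (epsNorm ε δ) (epsNorm ε δ') := by
  obtain ⟨y, rfl⟩ := h
  rw [epsNorm_mul_mul_inv ε hε]
  exact isConj_iff.2 ⟨y, rfl⟩

/-- **The norm is conjugate to its own twist**: `ε(N(δ)) = ε(δ) δ = δ⁻¹ N(δ) δ` for `ε ∘ ε = id` (generic form of ★ `isConj_epsNorm_unitaryTwist_epsNorm`).
[cite: Rogawski1990, §3.10 p. 33; §3.11 p. 34] -/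
theorem apply_epsNorm (hε : ∀ g : G, ε (ε g) = g) (δ : G) : ε (epsNorm ε δ) = δ⁻¹ * epsNorm ε δ * δ := by
  simp only [epsNorm, map_mul, hε]
  group

/-- `N(δ) ~ ε(N(δ))` (conjugate by `δ⁻¹`). [cite: Rogawski1990, §3.10 p. 33; §3.11 p. 34] -/
theorem isConj_epsNorm_apply_epsNorm (hε : ∀ g : G, ε (ε g) = g) (δ : G) : IsConj (epsNorm ε δ) (ε (epsNorm ε δ)) := by
  rw [apply_epsNorm ε hε]
  exact isConj_iff.2 ⟨δ⁻¹, by group⟩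

/-- **`N(δ)` lies in the ε-centralizer of `δ`**: `N(δ) δ ε(N(δ))⁻¹ = δ ε(δ) δ (ε(δ) δ)⁻¹ = δ` for `ε ∘ ε = id` (so `G̃_{δε} ∋ N(δ)`; for ε-regular `δ` this is the
inclusion `T(F)·… ⊂ G̃_{δε}` behind «`G̃(δε)″ = Z̃ G̃(δε)`», §3.11). [cite: Rogawski1990, §3.11 pp. 34–35] -/
theorem epsNorm_mem_epsCentralizer (hε : ∀ g : G, ε (ε g) = g) (δ : G) : epsNorm ε δ ∈ epsCentralizer ε δ := by
  rw [mem_epsCentralizer_iff, apply_epsNorm ε hε, epsNorm]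
  group

/-- `N(δ)` commutes with `δ ε(δ)`-twisting in the other order too: `ε(δ) ∈ G̃_{(ε δ) ε}`-style identity `N(ε δ) = ε(N(δ))`. [cite: Rogawski1990, §3.10 p. 33] -/
theorem epsNorm_apply (hε : ∀ g : G, ε (ε g) = g) (δ : G) : epsNorm ε (ε δ) = ε (epsNorm ε δ) := by
  simp only [epsNorm, map_mul, hε]

end Norm

/-! ## §3 `G̃ = GL_n(R)` with the unitary twist: «`γ ∈ 𝒩(δ)`» and stable ε-conjugacy descend along ε-classes -/

section Unitary

variable {R : Type*} [CommRing R] [TopologicalSpace R] {n : Type*} [Fintype n] [DecidableEq n] (σ : R →+* R) (Φ : GL n R)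

/-- **The `δ`-slot of «`γ ∈ 𝒩(δ)`» is ε-class invariant**: for `σ` an involution and `Φ` `σ`-hermitian (so `ε ∘ ε = id`, ★ `unitaryTwist_unitaryTwist`), if `γ` is a norm of `δ`
and `δ ~_ε δ′` then `γ` is a norm of `δ′` (`N(δ′) ~ N(δ) ~ γ`). [cite: Rogawski1990, §3.11 p. 34] -/
theorem isEpsNorm_of_isEpsConj (hσ : ∀ x, σ (σ x) = x) (hΦ : ((Φ : GL n R) : Matrix n n R)ᵀ.map σ = (Φ : Matrix n n R))
    {δ δ' : GL n R} {γ : ↥(unitaryGroup σ (Φ : Matrix n n R))} (h : IsEpsNorm σ Φ δ γ) (hc : IsEpsConj (unitaryTwist σ Φ) δ δ') :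
    IsEpsNorm σ Φ δ' γ :=
  (isConj_epsNorm_of_isEpsConj (Cruxes.H413.K2E1TwistEpsilonInvolution.unitaryTwist_unitaryTwist σ hσ hΦ) hc).symm.trans h

/-- **The `γ`-slot of «`γ ∈ 𝒩(δ)`» is conjugacy invariant**: if `γ` is a norm of `δ` and `γ ~ γ′` in `U_Φ(R)` then `γ′` is a norm of `δ` (`𝒩(δ)` is a union of classes —
print: a STABLE class; the tree's `IsEpsNorm` is `GL_n(R)`-conjugacy, ★ `Ch4Sec10` docstring). [cite: Rogawski1990, §3.11 p. 34] -/
theorem isEpsNorm_of_isConj {δ : GL n R} {γ γ' : ↥(unitaryGroup σ (Φ : Matrix n n R))} (h : IsEpsNorm σ Φ δ γ) (hγ : IsConj γ γ') :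
    IsEpsNorm σ Φ δ γ' :=
  h.trans ((unitaryGroup σ (Φ : Matrix n n R)).subtype.map_isConj hγ)

/-- «`γ ∈ 𝒩(δ)`» is also invariant under `GL_n(R)`-conjugation of `γ` inside `U_Φ(R)` (the STABLE-class reading of `𝒩(δ)`). [cite: Rogawski1990, §3.11 p. 34] -/
theorem isEpsNorm_of_isConj_val {δ : GL n R} {γ γ' : ↥(unitaryGroup σ (Φ : Matrix n n R))} (h : IsEpsNorm σ Φ δ γ)
    (hγ : IsConj (γ : GL n R) (γ' : GL n R)) : IsEpsNorm σ Φ δ γ' :=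
  h.trans hγ

variable {σ Φ} in
/-- **ε-conjugate ⇒ stably ε-conjugate** (`N(δ) ~ N(δ′)`; the tree's `IsStablyEpsConj` is «the norms are `GL_n(R)`-conjugate», Prop. 3.11.1 (c) read as a definition).
[cite: Rogawski1990, §3.1 p. 19; §3.11 Prop. 3.11.1 (c) p. 34] -/
theorem isStablyEpsConj_of_isEpsConj (hσ : ∀ x, σ (σ x) = x) (hΦ : ((Φ : GL n R) : Matrix n n R)ᵀ.map σ = (Φ : Matrix n n R))
    {δ δ' : GL n R} (h : IsEpsConj (unitaryTwist σ Φ) δ δ') : IsStablyEpsConj σ Φ δ δ' :=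
  isConj_epsNorm_of_isEpsConj (Cruxes.H413.K2E1TwistEpsilonInvolution.unitaryTwist_unitaryTwist σ hσ hΦ) h

/-- Stable ε-conjugacy is an equivalence relation (it is `IsConj` of the norms; no hypothesis on `σ`, `Φ`). [cite: Rogawski1990, §3.11 p. 34] -/
theorem equivalence_isStablyEpsConj : Equivalence (IsStablyEpsConj σ Φ) :=
  ⟨fun _ => IsConj.refl _, fun h => IsConj.symm h, fun h h' => IsConj.trans h h'⟩

/-- If `γ` is a norm of both `δ` and `δ′` then `δ, δ′` are stably ε-conjugate (`N(δ) ~ γ ~ N(δ′)`): the fibres of `𝒩` are stable ε-classes («the norm map defines a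
bijection between `𝒪_{ε-st}(G̃)` and `𝒪_st(G)`», Prop. 3.11.1 (c), the injectivity half in the tree's currency). [cite: Rogawski1990, §3.11 Prop. 3.11.1 (c) p. 34] -/
theorem isStablyEpsConj_of_isEpsNorm {δ δ' : GL n R} {γ : ↥(unitaryGroup σ (Φ : Matrix n n R))} (h : IsEpsNorm σ Φ δ γ) (h' : IsEpsNorm σ Φ δ' γ) :
    IsStablyEpsConj σ Φ δ δ' :=
  IsConj.trans h (IsConj.symm h')

end Unitary

/-! ## §4 (ED. 2) (3.10.1): the ε-centralizer of `δ` centralizes the norm `N(δ)` — `G̃_{δε} ≤ G̃_{N(δ)}` (item contributed by K2E3-p34 (g2), R90 bus 2026-09-04T16:08:48Z) -/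

section NormCentralizer

variable {G : Type*} [Group G] (ε : G →* G)

variable {ε} in
/-- **`c ∈ G̃_{δε} ⇒ c N(δ) c⁻¹ = N(δ)`** for `ε ∘ ε = id`: from `c δ ε(c)⁻¹ = δ` get `c δ = δ ε(c)`, apply `ε` to get `ε(c) ε(δ) = ε(δ) c`, and so
`c δ ε(δ) c⁻¹ = δ ε(c) ε(δ) c⁻¹ = δ ε(δ) c c⁻¹ = N(δ)` — print (3.10.1) «`G̃_{δε} ⊂ G̃_{Nδ}`», the first step of «`G̃(δε)″ = Z̃ G̃(δε)`» (§3.11).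
[cite: Rogawski1990, §3.10 (3.10.1) p. 34; §3.11 p. 35] -/
theorem mul_epsNorm_mul_inv_eq_of_mem_epsCentralizer (hε : ∀ g : G, ε (ε g) = g) {δ c : G} (hc : c ∈ epsCentralizer ε δ) :
    c * epsNorm ε δ * c⁻¹ = epsNorm ε δ := by
  rw [mem_epsCentralizer_iff] at hc
  have h1 : c * δ = δ * ε c := by
    calc c * δ = c * δ * (ε c)⁻¹ * ε c := by group
      _ = δ * ε c := by rw [hc]
  have h2 : ε c * ε δ = ε δ * c := by
    have h := congrArg ε h1
    rwa [map_mul, map_mul, hε] at h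
  calc c * epsNorm ε δ * c⁻¹ = c * δ * ε δ * c⁻¹ := by simp only [epsNorm, mul_assoc]
    _ = δ * (ε c * ε δ) * c⁻¹ := by rw [h1]; group
    _ = δ * (ε δ * c) * c⁻¹ := by rw [h2]
    _ = epsNorm ε δ := by simp only [epsNorm]; group

/-- **(3.10.1) `G̃_{δε} ≤ G̃_{N(δ)}`**: the ε-centralizer of `δ` is contained in the centralizer of the norm `N(δ) = δ ε(δ)` (for `ε ∘ ε = id`; Mathlib `Subgroup.centralizer`).
For ε-regular `δ` print sharpens this to «`G̃(δε)″ = Z̃ G̃(δε)`» (Prop. 3.11.2 (c)), not claimed here. [cite: Rogawski1990, §3.10 (3.10.1) p. 34; §3.11 Prop. 3.11.2 (c) p. 35] -/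
theorem epsCentralizer_le_centralizer_epsNorm (hε : ∀ g : G, ε (ε g) = g) (δ : G) :
    epsCentralizer ε δ ≤ Subgroup.centralizer {epsNorm ε δ} := by
  intro c hc
  rw [Subgroup.mem_centralizer_singleton_iff]
  calc c * epsNorm ε δ = c * epsNorm ε δ * c⁻¹ * c := by group
    _ = epsNorm ε δ * c := by rw [mul_epsNorm_mul_inv_eq_of_mem_epsCentralizer hε hc]

/-- `N(δ)` commutes with every element of `G̃_{δε}` (pointwise form of (3.10.1)). [cite: Rogawski1990, §3.10 (3.10.1) p. 34] -/
theorem commute_epsNorm_of_mem_epsCentralizer (hε : ∀ g : G, ε (ε g) = g) {δ c : G} (hc : c ∈ epsCentralizer ε δ) :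
    Commute c (epsNorm ε δ) := by
  have h := mul_epsNorm_mul_inv_eq_of_mem_epsCentralizer hε hc
  calc c * epsNorm ε δ = c * epsNorm ε δ * c⁻¹ * c := by group
    _ = epsNorm ε δ * c := by rw [h]

end NormCentralizer

end Summit.HodgeConjecture.HodgeConjecture.R90.S4

end
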